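import Summits.CriticalPhenomena.PercolationContinuityZ3.Theses.PercShatteringRace
import Summits.CriticalPhenomena.PercolationContinuityZ3.Theorems.FreeBoxSparse.Negative.CentredForms
import Literature.Probability.Percolation.SharpnessDCTProofs
import Literature.Probability.LatticeModels.ThermodynamicLimit
import HarnessLib

/-!
# Crux `PercShatteringRace.FreeSusceptibilityPowerSaving` = S(1/2) (stmt-CriticalPhenomena-5786), line `bk-hyperscaling-tail-transfer` — bridge stub `stub_unrootedSplit` (census Dc3: `KMAX₄(21/2) ∧ NONPROLIF₂(1/2) ⟹ S`)

Helper file of the line lead c3, `--supports stmt-CriticalPhenomena-5786`.  The crux S(1/2) asks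
`χᶠ_R := Σ_{y ∈ Λ_R} P_{p_c}(0 ↔ y inside Λ_R) ≤ C R^{5/2}` (`Λ_R = box 3 R`, critical bond percolation on `ℤ³`).
The route's foreseen split through `E|K_max(Λ_R)| ≤ C R^{5/2}` is numerically dead (`d_f = 2.523 > 5/2`); the
crux-strategist's census (`Cruxes/FreeSusceptibilityPowerSaving/STRATEGY-CENSUS.md` §5 Dc3) typed its repair, a fully
UNROOTED split with sound margins (0.4/0.4), recorded only as a `sorry` in the non-importable `CensusSignatures.lean`.
Here it is proved: with `C_N(x)` the in-box cluster of `x` in `Λ_N`, `|K_max(Λ_N)| = max_x |C_N(x)|` and `N_R` the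
number of DISTINCT in-box clusters of `Λ_{2R}` of size `≥ ⌈R^{5/2}⌉`,
`[∀ R ≥ 1, E|K_max(Λ_{2R})|⁴ ≤ C₁ R^{21/2}] → [∀ R ≥ 1, E N_R² ≤ C₂ R^{1/2}] → FreeSusceptibilityPowerSaving` (BY NAME).
Proof: (i) box-inclusion averaging — `|Λ_R| χᶠ_R ≤ Σ_{u,v ∈ Λ_{2R}} P(u ↔ v in Λ_{2R}) = E Σ_{u ∈ Λ_{2R}} |C_{2R}(u)|`
(translation invariance; in tree as `FreeBoxSparse.Negative.card_mul_centredSum_le_pairSum`); (ii) pointwise counting —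
`Σ_u |C(u)| ≤ |Λ| N₀ + N_fat K_max²` (fat roots grouped by cluster; the fibre of `K` lies in `K`); (iii) Cauchy–Schwarz
`E[N_fat K_max²] ≤ (E N_fat²)^{1/2}(E K_max⁴)^{1/2}` (bounded functions of finitely many edges); (iv) arithmetic:
`χᶠ_R ≤ 8(R^{5/2} + 1) + √(C₁C₂) R^{11/2}/|Λ_R| ≤ (16 + √(C₁C₂)) R^{5/2}`.  Both antecedents are OPEN and engine-less
(census: `KMAX₄` = crux 4447's wall in `K_max` costume, kills the monolith; `NONPROLIF₂` needs a non-BK counting engine,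
kills proliferation; jointly ⟺ `b ≥ 1/5` ⟺ S on the shattered family).  No definitions, no notation: the in-box
cluster `C_N(x)(ω)` is spelled `(box 3 N).filter fun v => ω ∈ openConnIn ↑(box 3 N) x v` throughout.
-/

noncomputable section

namespace Summit.CriticalPhenomena.PercolationContinuityZ3.Theorems

open MeasureTheory Finset
open Literature.Probability.Percolation Literature.Probability.LatticeModels
open Literature.Probability.Percolation.DCT16
open scoped Classical

namespace StubUnrootedSplit

/-! ## Deterministic facts about in-box clusters -/

/-- A root in the box lies in its own in-box cluster. [folklore] -/
theorem self_mem_cl {N : ℕ} {x : Site 3} (hx : x ∈ box 3 N) (ω : BondConfig (Site 3)) :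
    x ∈ ((box 3 N).filter fun v => ω ∈ openConnIn (↑(box 3 N) : Set (Site 3)) x v) := by
  refine mem_filter.2 ⟨hx, ?_⟩
  exact ⟨Finset.mem_coe.2 hx, Finset.mem_coe.2 hx, SimpleGraph.Reachable.refl _⟩

/-- In-box clusters have at most `|Λ_N|` sites. [folklore] -/
theorem card_cl_le {N : ℕ} (x : Site 3) (ω : BondConfig (Site 3)) :
    (((box 3 N).filter fun v => ω ∈ openConnIn (↑(box 3 N) : Set (Site 3)) x v)).card ≤ (box 3 N).card :=
  card_filter_le _ _

/-- The largest in-box cluster has at most `|Λ_N|` sites. [folklore] -/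
theorem kmax_le_card (N : ℕ) (ω : BondConfig (Site 3)) :
    ((box 3 N).sup fun x => (((box 3 N).filter fun v => ω ∈ openConnIn (↑(box 3 N) : Set (Site 3)) x v)).card) ≤ (box 3 N).card :=
  Finset.sup_le fun x _ => card_cl_le x ω

/-- The number of fat in-box clusters is at most `|Λ_N|`. [folklore] -/
theorem nfat_le_card (N n : ℕ) (ω : BondConfig (Site 3)) :
    (((box 3 N).filter fun x => n ≤ (((box 3 N).filter fun v => ω ∈ openConnIn (↑(box 3 N) : Set (Site 3)) x v)).card).image fun x => ((box 3 N).filter fun v => ω ∈ openConnIn (↑(box 3 N) : Set (Site 3)) x v)).card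
      ≤ (box 3 N).card :=
  card_image_le.trans (card_filter_le _ _)

/-- **Pointwise counting** (census Dc3 (ii)): for any finite set of roots `Λ`, any "cluster map"
`C : α → Finset α` with `u ∈ C u` on `Λ`, and any threshold `n`,
`Σ_{u ∈ Λ} |C u| ≤ |Λ| · n + #{C u : u ∈ Λ fat} · (max_{u ∈ Λ} |C u|)²` — thin roots contribute `< n`
each; fat roots are grouped by their cluster, whose fibre lies inside the cluster. [folklore] -/
theorem sum_card_le_of_clusters {α : Type*} [DecidableEq α] (Λ : Finset α) (C : α → Finset α)
    (hself : ∀ u ∈ Λ, u ∈ C u) (n : ℕ) :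
    ∑ u ∈ Λ, (C u).card ≤ Λ.card * n +
      ((Λ.filter fun u => n ≤ (C u).card).image C).card * (Λ.sup fun u => (C u).card) ^ 2 := by
  set F : Finset α := Λ.filter fun u => n ≤ (C u).card with hF
  set M : ℕ := Λ.sup fun u => (C u).card with hM
  -- split the roots into thin and fat
  have hsplit : ∑ u ∈ Λ, (C u).card =
      ∑ u ∈ Λ.filter (fun u => ¬ n ≤ (C u).card), (C u).card + ∑ u ∈ F, (C u).card := by
    rw [hF, add_comm, Finset.sum_filter_add_sum_filter_not]
  -- thin roots
  have hthin : ∑ u ∈ Λ.filter (fun u => ¬ n ≤ (C u).card), (C u).card ≤ Λ.card * n := by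
    calc ∑ u ∈ Λ.filter (fun u => ¬ n ≤ (C u).card), (C u).card
        ≤ ∑ _u ∈ Λ.filter (fun u => ¬ n ≤ (C u).card), n :=
          Finset.sum_le_sum fun u hu => (not_le.1 (mem_filter.1 hu).2).le
      _ = (Λ.filter (fun u => ¬ n ≤ (C u).card)).card * n := by rw [sum_const, smul_eq_mul]
      _ ≤ Λ.card * n := Nat.mul_le_mul_right _ (card_filter_le _ _)
  -- fat roots, grouped by cluster
  have hmaps : ∀ u ∈ F, C u ∈ F.image C := fun u hu => mem_image_of_mem C hu
  have hfat : ∑ u ∈ F, (C u).card ≤ (F.image C).card * M ^ 2 := by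
    rw [← Finset.sum_fiberwise_of_maps_to' hmaps (fun K => K.card)]
    calc ∑ K ∈ F.image C, ∑ _u ∈ F.filter (fun u => C u = K), K.card
        ≤ ∑ _K ∈ F.image C, M ^ 2 := by
          refine Finset.sum_le_sum fun K hK => ?_
          obtain ⟨u₀, hu₀, rfl⟩ := mem_image.1 hK
          have hKM : (C u₀).card ≤ M := by
            rw [hM]; exact Finset.le_sup (f := fun u => (C u).card) (mem_filter.1 hu₀).1
          -- the fibre of `C u₀` is contained in `C u₀`
          have hfib : (F.filter fun u => C u = C u₀).card ≤ (C u₀).card := by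
            refine card_le_card fun u hu => ?_
            obtain ⟨huF, huK⟩ := mem_filter.1 hu
            rw [← huK]
            exact hself u (mem_filter.1 huF).1
          calc ∑ _u ∈ F.filter (fun u => C u = C u₀), (C u₀).card
              = (F.filter fun u => C u = C u₀).card * (C u₀).card := by rw [sum_const, smul_eq_mul]
            _ ≤ M * M := Nat.mul_le_mul (hfib.trans hKM) hKM
            _ = M ^ 2 := (sq M).symm
      _ = (F.image C).card * M ^ 2 := by rw [sum_const, smul_eq_mul]
  rw [hsplit]
  exact add_le_add hthin hfat

/-! ## Dependence on the edges of the box; measurability -/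

/-- In-box clusters depend only on the states of the pairs of sites of the box. [folklore] -/
theorem cl_eq_of_inter_eq {N : ℕ} {ω ω' : BondConfig (Site 3)}
    (h : ω ∩ (↑((box 3 N).sym2) : Set (Sym2 (Site 3))) = ω' ∩ ↑((box 3 N).sym2)) (x : Site 3) :
    ((box 3 N).filter fun v => ω ∈ openConnIn (↑(box 3 N) : Set (Site 3)) x v) = ((box 3 N).filter fun v => ω' ∈ openConnIn (↑(box 3 N) : Set (Site 3)) x v) := by
  refine Finset.filter_congr fun v _ => ?_
  have hK : (↑(box 3 N) : Set (Site 3)).sym2 ⊆ (↑((box 3 N).sym2) : Set (Sym2 (Site 3))) := by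
    rw [Finset.coe_sym2]
  exact (determinedBy_iff _ _).1 (determinedBy_openConnIn (↑(box 3 N) : Set (Site 3)) x v hK) ω ω' h

/-- A function of the configuration that depends only on finitely many pairs and takes values in a
countable type is measurable (every fibre is a cylinder event). [folklore] -/
theorem measurable_of_dependsOn {β : Type*} [MeasurableSpace β] [Countable β]
    (F : Finset (Sym2 (Site 3))) {f : BondConfig (Site 3) → β}
    (hf : ∀ ω ω' : BondConfig (Site 3), ω ∩ ↑F = ω' ∩ ↑F → f ω = f ω') : Measurable f := by
  refine measurable_to_countable fun ω₀ => ?_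
  have hD : DeterminedBy (f ⁻¹' {f ω₀}) (↑F : Set (Sym2 (Site 3))) := by
    rw [determinedBy_iff]
    intro ω ω' h
    simp only [Set.mem_preimage, Set.mem_singleton_iff, hf ω ω' h]
  exact hD.measurableSet_of_finset

/-- Any (real-valued cast of a natural-number) function of the family of in-box clusters
`(C_N(x)(ω))_x` is measurable — it depends only on the pairs of the box. [folklore] -/
theorem measurable_fun_cl (N : ℕ) (G : (Site 3 → Finset (Site 3)) → ℕ) :
    Measurable fun ω : BondConfig (Site 3) => ((G fun x => ((box 3 N).filter fun v => ω ∈ openConnIn (↑(box 3 N) : Set (Site 3)) x v) : ℕ) : ℝ) :=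
  measurable_from_nat.comp (measurable_of_dependsOn ((box 3 N).sym2)
    (f := fun ω => G fun x => ((box 3 N).filter fun v => ω ∈ openConnIn (↑(box 3 N) : Set (Site 3)) x v)) fun ω ω' hω => by simp only [cl_eq_of_inter_eq hω])

/-! ## Probabilistic steps -/

/-- `Σ_{v ∈ Λ_N} P(u ↔ v in Λ_N) = E|C_N(u)|`. [folklore] -/
theorem sum_real_eq_integral_card (N : ℕ) (u : Site 3) :
    ∑ v ∈ box 3 N, (bondPercolation (zdGraph 3) (criticalProbI 3)).real
        (openConnIn (↑(box 3 N) : Set (Site 3)) u v)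
      = ∫ ω, ((((box 3 N).filter fun v => ω ∈ openConnIn (↑(box 3 N) : Set (Site 3)) u v)).card : ℝ) ∂(bondPercolation (zdGraph 3) (criticalProbI 3)) := by
  have hcard : ∀ ω : BondConfig (Site 3), ((((box 3 N).filter fun v => ω ∈ openConnIn (↑(box 3 N) : Set (Site 3)) u v)).card : ℝ) =
      ∑ v ∈ box 3 N, (openConnIn (↑(box 3 N) : Set (Site 3)) u v).indicator (1 : BondConfig (Site 3) → ℝ) ω := by
    intro ω
    rw [card_filter, Nat.cast_sum]
    refine Finset.sum_congr rfl fun v _ => ?_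
    by_cases hv : ω ∈ openConnIn (↑(box 3 N) : Set (Site 3)) u v
    · rw [if_pos hv, Set.indicator_of_mem hv]; simp
    · rw [if_neg hv, Set.indicator_of_notMem hv]; simp
  simp_rw [hcard]
  rw [integral_finsetSum _ fun v _ => ?_]
  · refine Finset.sum_congr rfl fun v _ => ?_
    rw [integral_indicator_one (measurableSet_openConnIn (box 3 N) u v)]
  · exact (integrable_const (1 : ℝ)).indicator (measurableSet_openConnIn (box 3 N) u v)

end StubUnrootedSplit

open StubUnrootedSplit in
/-- **Census Dc3 — the fully unrooted split `KMAX₄(21/2) ∧ NONPROLIF₂(1/2) ⟹ S(1/2)`** (strategist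
`STRATEGY-CENSUS.md` §5 Dc3; the numerically sound repair — margins 0.4/0.4 — of the route's dead foreseen split
through `E|K_max|`).  If `E |K_max(Λ_{2R})|⁴ ≤ C₁ R^{21/2}` and `E N_R² ≤ C₂ R^{1/2}` for all `R ≥ 1`, where
`|K_max(Λ_{2R})| = max_x |C_{2R}(x)|` is the largest in-box cluster and `N_R` the number of distinct in-box
clusters of `Λ_{2R}` of size `≥ ⌈R^{5/2}⌉`, then `Σ_{y ∈ Λ_R} P_{p_c}(0 ↔ y in Λ_R) ≤ (16 + √(C₁C₂)) R^{5/2}`: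
box-inclusion averaging, pointwise counting `Σ_u |C(u)| ≤ |Λ| N₀ + N_fat K_max²`, Cauchy–Schwarz.  Both
antecedents are open (census: engine-less); this is interface glue, registered as the stub
`stub_unrootedSplit` of the bk skeleton. [folklore] -/
theorem stub_unrootedSplit :
    (∃ C : ℝ, ∀ R : ℕ, 1 ≤ R →
        ∫ ω, (((box 3 (2 * R)).sup fun x =>
            ((box 3 (2 * R)).filter fun v => ω ∈ openConnIn ↑(box 3 (2 * R)) x v).card : ℕ) : ℝ) ^ 4
          ∂(bondPercolation (zdGraph 3) (criticalProbI 3)) ≤ C * (R : ℝ) ^ ((21 : ℝ) / 2)) →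
      (∃ C : ℝ, ∀ R : ℕ, 1 ≤ R →
        ∫ ω, (((((box 3 (2 * R)).filter fun x => ⌈(R : ℝ) ^ ((5 : ℝ) / 2)⌉₊ ≤
              ((box 3 (2 * R)).filter fun v => ω ∈ openConnIn ↑(box 3 (2 * R)) x v).card).image
            fun x => (box 3 (2 * R)).filter fun v => ω ∈ openConnIn ↑(box 3 (2 * R)) x v).card : ℕ) : ℝ) ^ 2
          ∂(bondPercolation (zdGraph 3) (criticalProbI 3)) ≤ C * (R : ℝ) ^ ((1 : ℝ) / 2)) →
      Summit.CriticalPhenomena.PercolationContinuityZ3.Theses.PercShatteringRace.FreeSusceptibilityPowerSaving := by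
  rintro ⟨C₁, hK⟩ ⟨C₂, hN⟩
  refine ⟨16 + Real.sqrt (C₁ * C₂), fun R hR => ?_⟩
  set μ := bondPercolation (zdGraph 3) (criticalProbI 3) with hμ
  set N : ℕ := 2 * R with hNdef
  set n₀ : ℕ := ⌈(R : ℝ) ^ ((5 : ℝ) / 2)⌉₊ with hn₀
  set kmax : BondConfig (Site 3) → ℝ := fun ω =>
    (((box 3 N).sup fun x => (((box 3 N).filter fun v => ω ∈ openConnIn (↑(box 3 N) : Set (Site 3)) x v)).card : ℕ) : ℝ) with hkmax
  set nfat : BondConfig (Site 3) → ℝ := fun ω =>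
    ((((box 3 N).filter fun x => n₀ ≤ (((box 3 N).filter fun v => ω ∈ openConnIn (↑(box 3 N) : Set (Site 3)) x v)).card).image fun x => ((box 3 N).filter fun v => ω ∈ openConnIn (↑(box 3 N) : Set (Site 3)) x v)).card : ℝ) with hnfat
  set T : BondConfig (Site 3) → ℝ := fun ω => ((∑ u ∈ box 3 N, (((box 3 N).filter fun v => ω ∈ openConnIn (↑(box 3 N) : Set (Site 3)) u v)).card : ℕ) : ℝ) with hT
  have hK' : ∫ ω, kmax ω ^ 4 ∂μ ≤ C₁ * (R : ℝ) ^ ((21 : ℝ) / 2) := hK R hR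
  have hN' : ∫ ω, nfat ω ^ 2 ∂μ ≤ C₂ * (R : ℝ) ^ ((1 : ℝ) / 2) := hN R hR
  have hR1 : (1 : ℝ) ≤ R := by exact_mod_cast hR
  have hR0 : (0 : ℝ) < R := by linarith
  set s : ℝ := ((box 3 R).card : ℝ) with hs
  set b : ℝ := ((box 3 N).card : ℝ) with hb
  have hs_eq : s = (2 * (R : ℝ) + 1) ^ 3 := by rw [hs, card_box]; push_cast; ring
  have hs0 : 0 < s := by rw [hs_eq]; positivity
  have hbs : b ≤ 8 * s := FreeBoxSparse.Negative.card_box_two_mul_le R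
  have hR3s : (R : ℝ) ^ (3 : ℕ) ≤ s := by
    rw [hs_eq]; exact pow_le_pow_left₀ hR0.le (by linarith) 3
  have mk : Measurable kmax := measurable_fun_cl N fun C => (box 3 N).sup fun x => (C x).card
  have mn : Measurable nfat :=
    measurable_fun_cl N fun C => (((box 3 N).filter fun x => n₀ ≤ (C x).card).image C).card
  have mT : Measurable T := measurable_fun_cl N fun C => ∑ u ∈ box 3 N, (C u).card
  have kmax_nn : ∀ ω, 0 ≤ kmax ω := fun ω => Nat.cast_nonneg _
  have nfat_nn : ∀ ω, 0 ≤ nfat ω := fun ω => Nat.cast_nonneg _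
  have kmax_le : ∀ ω, kmax ω ≤ b := fun ω => by simp only [hkmax, hb]; exact_mod_cast kmax_le_card N ω
  have nfat_le : ∀ ω, nfat ω ≤ b := fun ω => by simp only [hnfat, hb]; exact_mod_cast nfat_le_card N n₀ ω
  -- (ii) pointwise counting
  have hpt : ∀ ω, T ω ≤ b * n₀ + nfat ω * kmax ω ^ 2 := by
    intro ω
    have h := sum_card_le_of_clusters (box 3 N) (fun x => ((box 3 N).filter fun v => ω ∈ openConnIn (↑(box 3 N) : Set (Site 3)) x v)) (fun u hu => self_mem_cl hu ω) n₀
    simp only [hT, hb, hnfat, hkmax]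
    exact_mod_cast h
  -- (i) averaging: `s χ ≤ ∫ T`
  have hsumT : ∑ u ∈ box 3 N, ∫ ω, ((((box 3 N).filter fun v => ω ∈ openConnIn (↑(box 3 N) : Set (Site 3)) u v)).card : ℝ) ∂μ = ∫ ω, T ω ∂μ := by
    rw [hT]
    rw [← integral_finsetSum _ fun u _ => ?_]
    · refine integral_congr_ae (ae_of_all _ fun ω => ?_)
      push_cast; rfl
    · refine (integrable_const ((box 3 N).card : ℝ)).mono'
        (measurable_fun_cl N fun C => (C u).card).aestronglyMeasurable (ae_of_all _ fun ω => ?_)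
      rw [Real.norm_of_nonneg (Nat.cast_nonneg _)]
      exact_mod_cast card_cl_le u ω
  have havg : s * ∑ y ∈ box 3 R, μ.real (openConnIn (↑(box 3 R) : Set (Site 3)) 0 y) ≤ ∫ ω, T ω ∂μ := by
    calc s * ∑ y ∈ box 3 R, μ.real (openConnIn (↑(box 3 R) : Set (Site 3)) 0 y)
        ≤ ∑ u ∈ box 3 N, ∑ v ∈ box 3 N, μ.real (openConnIn (↑(box 3 N) : Set (Site 3)) u v) :=
          FreeBoxSparse.Negative.card_mul_centredSum_le_pairSum (criticalProbI 3) R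
      _ = ∑ u ∈ box 3 N, ∫ ω, ((((box 3 N).filter fun v => ω ∈ openConnIn (↑(box 3 N) : Set (Site 3)) u v)).card : ℝ) ∂μ :=
          Finset.sum_congr rfl fun u _ => sum_real_eq_integral_card N u
      _ = ∫ ω, T ω ∂μ := hsumT
  -- (iii) integrate the pointwise bound and apply Cauchy–Schwarz
  have int_prod : Integrable (fun ω => nfat ω * kmax ω ^ 2) μ := by
    refine (integrable_const (b * b ^ 2)).mono' ((mn.mul (mk.pow_const 2)).aestronglyMeasurable)
      (ae_of_all _ fun ω => ?_)
    rw [Real.norm_of_nonneg (mul_nonneg (nfat_nn ω) (sq_nonneg _))]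
    exact mul_le_mul (nfat_le ω) (pow_le_pow_left₀ (kmax_nn ω) (kmax_le ω) 2) (sq_nonneg _)
      (le_trans (nfat_nn ω) (nfat_le ω))
  have T_le : ∀ ω, T ω ≤ b * b := fun ω => by
    simp only [hT, hb]; push_cast
    calc ∑ u ∈ box 3 N, ((((box 3 N).filter fun v => ω ∈ openConnIn (↑(box 3 N) : Set (Site 3)) u v)).card : ℝ) ≤ ∑ _u ∈ box 3 N, ((box 3 N).card : ℝ) :=
          Finset.sum_le_sum fun u _ => by exact_mod_cast card_cl_le u ω
      _ = ((box 3 N).card : ℝ) * (box 3 N).card := by rw [sum_const, nsmul_eq_mul]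
  have int_T : Integrable T μ :=
    (integrable_const (b * b)).mono' mT.aestronglyMeasurable (ae_of_all _ fun ω => by
      rw [Real.norm_of_nonneg (by simp only [hT]; exact Nat.cast_nonneg _)]; exact T_le ω)
  have hintT : ∫ ω, T ω ∂μ ≤ b * n₀ + ∫ ω, nfat ω * kmax ω ^ 2 ∂μ := by
    calc ∫ ω, T ω ∂μ ≤ ∫ ω, (b * n₀ + nfat ω * kmax ω ^ 2) ∂μ :=
          integral_mono int_T ((integrable_const _).add int_prod) hpt
      _ = b * n₀ + ∫ ω, nfat ω * kmax ω ^ 2 ∂μ := by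
          rw [integral_add (integrable_const _) int_prod, integral_const, probReal_univ, one_smul]
  have hCS : ∫ ω, nfat ω * kmax ω ^ 2 ∂μ
      ≤ Real.sqrt (∫ ω, nfat ω ^ 2 ∂μ) * Real.sqrt (∫ ω, kmax ω ^ 4 ∂μ) := by
    have hf : MemLp nfat (ENNReal.ofReal 2) μ :=
      MemLp.of_bound mn.aestronglyMeasurable b (ae_of_all _ fun ω => by
        rw [Real.norm_of_nonneg (nfat_nn ω)]; exact nfat_le ω)
    have hg : MemLp (fun ω => kmax ω ^ 2) (ENNReal.ofReal 2) μ :=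
      MemLp.of_bound (mk.pow_const 2).aestronglyMeasurable (b ^ 2) (ae_of_all _ fun ω => by
        rw [Real.norm_of_nonneg (sq_nonneg _)]
        exact pow_le_pow_left₀ (kmax_nn ω) (kmax_le ω) 2)
    have h := integral_mul_le_Lp_mul_Lq_of_nonneg Real.HolderConjugate.two_two
      (ae_of_all _ fun ω => nfat_nn ω) (ae_of_all _ fun ω => sq_nonneg (kmax ω)) hf hg
    have e1 : (fun ω => nfat ω ^ (2 : ℝ)) = fun ω => nfat ω ^ 2 := by funext ω; rw [Real.rpow_two]
    have e2 : (fun ω => (kmax ω ^ 2) ^ (2 : ℝ)) = fun ω => kmax ω ^ 4 := by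
      funext ω; rw [Real.rpow_two]; ring
    rw [e1, e2] at h
    have hs1 : ∀ x : ℝ, x ^ (2 : ℝ)⁻¹ = Real.sqrt x := fun x => by rw [Real.sqrt_eq_rpow, one_div]
    simpa only [one_div, hs1] using h
  have hI1 : 0 ≤ ∫ ω, kmax ω ^ 4 ∂μ := integral_nonneg fun ω => by positivity
  have hI2 : 0 ≤ ∫ ω, nfat ω ^ 2 ∂μ := integral_nonneg fun ω => by positivity
  have hC1 : 0 ≤ C₁ := nonneg_of_mul_nonneg_left (hI1.trans hK') (Real.rpow_pos_of_pos hR0 _)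
  have hC2 : 0 ≤ C₂ := nonneg_of_mul_nonneg_left (hI2.trans hN') (Real.rpow_pos_of_pos hR0 _)
  -- `√(∫ nfat²) √(∫ kmax⁴) ≤ √(C₁C₂) R^{11/2}`
  have hsq : Real.sqrt (∫ ω, nfat ω ^ 2 ∂μ) * Real.sqrt (∫ ω, kmax ω ^ 4 ∂μ)
      ≤ Real.sqrt (C₁ * C₂) * (R : ℝ) ^ ((11 : ℝ) / 2) := by
    have h1 : Real.sqrt (∫ ω, nfat ω ^ 2 ∂μ) ≤ Real.sqrt (C₂ * (R : ℝ) ^ ((1 : ℝ) / 2)) := Real.sqrt_le_sqrt hN'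
    have h2 : Real.sqrt (∫ ω, kmax ω ^ 4 ∂μ) ≤ Real.sqrt (C₁ * (R : ℝ) ^ ((21 : ℝ) / 2)) := Real.sqrt_le_sqrt hK'
    have hpow : (R : ℝ) ^ ((1 : ℝ) / 2) * (R : ℝ) ^ ((21 : ℝ) / 2) = ((R : ℝ) ^ ((11 : ℝ) / 2)) ^ 2 := by
      rw [← Real.rpow_add hR0, sq, ← Real.rpow_add hR0]; norm_num
    have hprod : C₂ * (R : ℝ) ^ ((1 : ℝ) / 2) * (C₁ * (R : ℝ) ^ ((21 : ℝ) / 2))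
        = C₁ * C₂ * ((R : ℝ) ^ ((11 : ℝ) / 2)) ^ 2 := by rw [← hpow]; ring
    have hR11 : 0 ≤ (R : ℝ) ^ ((11 : ℝ) / 2) := Real.rpow_nonneg hR0.le _
    calc Real.sqrt (∫ ω, nfat ω ^ 2 ∂μ) * Real.sqrt (∫ ω, kmax ω ^ 4 ∂μ)
        ≤ Real.sqrt (C₂ * (R : ℝ) ^ ((1 : ℝ) / 2)) * Real.sqrt (C₁ * (R : ℝ) ^ ((21 : ℝ) / 2)) :=
          mul_le_mul h1 h2 (Real.sqrt_nonneg _) (Real.sqrt_nonneg _)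
      _ = Real.sqrt (C₂ * (R : ℝ) ^ ((1 : ℝ) / 2) * (C₁ * (R : ℝ) ^ ((21 : ℝ) / 2))) := by
          rw [← Real.sqrt_mul (mul_nonneg hC2 (Real.rpow_nonneg hR0.le _))]
      _ = Real.sqrt (C₁ * C₂) * (R : ℝ) ^ ((11 : ℝ) / 2) := by
          rw [hprod, Real.sqrt_mul (mul_nonneg hC1 hC2), Real.sqrt_sq hR11]
  have hn₀le : (n₀ : ℝ) ≤ 2 * (R : ℝ) ^ ((5 : ℝ) / 2) := by
    have h1 : (n₀ : ℝ) < (R : ℝ) ^ ((5 : ℝ) / 2) + 1 := Nat.ceil_lt_add_one (Real.rpow_nonneg hR0.le _)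
    have h2 : (1 : ℝ) ≤ (R : ℝ) ^ ((5 : ℝ) / 2) := Real.one_le_rpow hR1 (by norm_num)
    linarith
  have hR11 : (R : ℝ) ^ ((11 : ℝ) / 2) ≤ (R : ℝ) ^ ((5 : ℝ) / 2) * s := by
    have : (R : ℝ) ^ ((11 : ℝ) / 2) = (R : ℝ) ^ ((5 : ℝ) / 2) * (R : ℝ) ^ (3 : ℕ) := by
      rw [← Real.rpow_natCast, ← Real.rpow_add hR0]; norm_num
    rw [this]
    exact mul_le_mul_of_nonneg_left hR3s (Real.rpow_nonneg hR0.le _)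
  -- assemble: `s χ ≤ b n₀ + √(C₁C₂) R^{11/2} ≤ s (16 + √(C₁C₂)) R^{5/2}`
  have hmain : s * ∑ y ∈ box 3 R, μ.real (openConnIn (↑(box 3 R) : Set (Site 3)) 0 y)
      ≤ s * ((16 + Real.sqrt (C₁ * C₂)) * (R : ℝ) ^ ((5 : ℝ) / 2)) := by
    have hR52 : 0 ≤ (R : ℝ) ^ ((5 : ℝ) / 2) := Real.rpow_nonneg hR0.le _
    have hsqrt0 : 0 ≤ Real.sqrt (C₁ * C₂) := Real.sqrt_nonneg _
    calc s * ∑ y ∈ box 3 R, μ.real (openConnIn (↑(box 3 R) : Set (Site 3)) 0 y)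
        ≤ ∫ ω, T ω ∂μ := havg
      _ ≤ b * n₀ + Real.sqrt (C₁ * C₂) * (R : ℝ) ^ ((11 : ℝ) / 2) := by linarith [hintT, hCS, hsq]
      _ ≤ 8 * s * (2 * (R : ℝ) ^ ((5 : ℝ) / 2)) + Real.sqrt (C₁ * C₂) * ((R : ℝ) ^ ((5 : ℝ) / 2) * s) := by
          have hb0 : 0 ≤ b := le_trans (kmax_nn ∅) (kmax_le ∅)
          have : b * (n₀ : ℝ) ≤ 8 * s * (2 * (R : ℝ) ^ ((5 : ℝ) / 2)) :=
            mul_le_mul hbs hn₀le (Nat.cast_nonneg _) (by positivity)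
          have : Real.sqrt (C₁ * C₂) * (R : ℝ) ^ ((11 : ℝ) / 2)
              ≤ Real.sqrt (C₁ * C₂) * ((R : ℝ) ^ ((5 : ℝ) / 2) * s) :=
            mul_le_mul_of_nonneg_left hR11 hsqrt0
          linarith
      _ = s * ((16 + Real.sqrt (C₁ * C₂)) * (R : ℝ) ^ ((5 : ℝ) / 2)) := by ring
  exact le_of_mul_le_mul_left hmain hs0

end Summit.CriticalPhenomena.PercolationContinuityZ3.Theorems

end
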